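import Literature.Probability.LatticeModels.BattleFederbushTreeDecay
import Mathlib.Analysis.SpecificLimits.Basic
import HarnessLib

/-!
# Tree sums with bounded row sums, and the "short memory" scale sums

Topic `Literature/Probability/LatticeModels`; a companion of `BattleFederbushTreeDecay.lean`.  Two
elementary summations over a rooted tree (given, as there, by a script `s : Script root k` — points
`y₀, …, y_k` added one at a time, each with a parent among the earlier ones) used in the bounds of
multiscale cluster expansions:

* `Script.sum_lineWeightProd₂_le` — **tree sums with bounded row sums**: for two-point line
  weights `g_t(b, c) ≥ 0` (parent at `b`, child at `c`) with `Σ_c g_t(b, c) ≤ B_t` for every `b`,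
  `Σ_{x : x_root = a} ∏_t g_t(x_{parent}, x_{child}) ≤ ∏_t B_t` — the non translation invariant
  form of the tree-decay lemma (Benfatto–Giuliani–Mastropietro 2006, proof of (2.77));
* `Script.sum_scaleWeightProd_le` — **the short memory property**: summing, over scale labels
  `h_v` increasing along the tree (`h_child > h_parent`, the root scale fixed, all scales in a
  finite window), the product of the factors `θ^{h_child - h_parent}` (`0 ≤ θ < 1`, `θ = γ^{-α}`)
  gives at most `(θ/(1-θ))^{#lines}` (Mastropietro 2008, §3.1, the sum over the scale labels after
  (3.25)/(3.31); Benfatto–Giuliani–Mastropietro 2006, §3, the bound after (3.6):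
  "the sum over the scales is done using the factors `γ^{-α(h_v - h_{v'})}`").

Everything is proved; no named fact. [folklore]

## Sources

G. Benfatto, A. Giuliani, V. Mastropietro, Ann. Henri Poincaré 7 (2006), proof of Thm. 2.1 and §3
(`BenfattoGiulianiMastropietro2006`); V. Mastropietro, *Non-Perturbative Renormalization* (2008),
§3.1–3.2 (`Mastropietro2008`).
-/

noncomputable section

open Finset

namespace Literature.Probability.LatticeModels

namespace BattleFederbush

namespace Script

variable {ι : Type*} {root : ι} {P : Type*} {R : Type*} [CommSemiring R] [PartialOrder R] [IsOrderedRing R]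

/-- **The product of two-point line weights of a script** at positions `x : Fin (k + 1) → P`: the
line created by `snoc s i z` contributes `g_last (x_parent, x_child)`. [folklore] -/
def lineWeightProd₂ : {k : ℕ} → Script root k → (Fin k → P → P → R) → (Fin (k + 1) → P) → R
  | _, nil, _, _ => 1
  | _, snoc s i _, g, x =>
    lineWeightProd₂ s (fun t => g t.castSucc) (fun m => x m.castSucc) * g (Fin.last _) (x i.castSucc) (x (Fin.last _))

omit [PartialOrder R] [IsOrderedRing R] in
/-- The root alone carries no line. [folklore] -/
@[simp] theorem lineWeightProd₂_nil (g : Fin 0 → P → P → R) (x : Fin 1 → P) :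
    (nil : Script root 0).lineWeightProd₂ g x = 1 := rfl

omit [PartialOrder R] [IsOrderedRing R] in
/-- Peeling the last line. [folklore] -/
theorem lineWeightProd₂_snoc {k : ℕ} (s : Script root k) (i : Fin (k + 1)) (z : ι) (g : Fin (k + 1) → P → P → R)
    (x : Fin (k + 2) → P) :
    (snoc s i z).lineWeightProd₂ g x =
      s.lineWeightProd₂ (fun t => g t.castSucc) (fun m => x m.castSucc) *
        g (Fin.last _) (x i.castSucc) (x (Fin.last _)) :=
  rfl

/-- The product of nonnegative line weights is nonnegative. [folklore] -/
theorem lineWeightProd₂_nonneg : {k : ℕ} → (s : Script root k) → (g : Fin k → P → P → R) →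
    (hg : ∀ t b c, 0 ≤ g t b c) → (x : Fin (k + 1) → P) → 0 ≤ s.lineWeightProd₂ g x
  | _, nil, _, _, _ => zero_le_one
  | _, snoc s i z, g, hg, x => by
    rw [lineWeightProd₂_snoc]
    exact mul_nonneg (lineWeightProd₂_nonneg s _ (fun t b c => hg _ b c) _) (hg _ _ _)

variable [Fintype P] [DecidableEq P]

/-- **Tree sums with bounded row sums**: if `g_t ≥ 0` and `Σ_c g_t(b, c) ≤ B_t` for all `b`, then,
the root being held at `a`, `Σ_{x : x₀ = a} ∏_t g_t(x_{parent}, x_{child}) ≤ ∏_t B_t`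
(Benfatto–Giuliani–Mastropietro 2006, proof of (2.77), without translation invariance). [folklore] -/
theorem sum_lineWeightProd₂_le : {k : ℕ} → (s : Script root k) → (g : Fin k → P → P → R) →
    (hg : ∀ t b c, 0 ≤ g t b c) → (B : Fin k → R) → (hB : ∀ t b, ∑ c, g t b c ≤ B t) → (a : P) →
    ∑ x ∈ univ.filter (fun x : Fin (k + 1) → P => x 0 = a), s.lineWeightProd₂ g x ≤ ∏ t, B t
  | _, nil, g, _, B, _, a => by
    rw [Fintype.prod_empty, Finset.sum_filter]
    simp only [lineWeightProd₂_nil]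
    rw [← (Equiv.funUnique (Fin 1) P).symm.sum_comp]
    simp [Equiv.funUnique, Finset.sum_ite_eq']
  | _, snoc (k := k) s i z, g, hg, B, hB, a => by
    have ih := sum_lineWeightProd₂_le s (fun t => g t.castSucc) (fun t b c => hg _ b c) (fun t => B t.castSucc)
      (fun t b => hB _ b) a
    have hB0 : ∀ t, 0 ≤ B t := fun t => le_trans (sum_nonneg fun c _ => hg t a c) (hB t a)
    rw [Fin.prod_univ_castSucc, Finset.sum_filter, ← (Fin.snocEquiv fun _ => P).sum_comp, Fintype.sum_prod_type,
      Finset.sum_comm]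
    have h0 : ∀ (x : Fin (k + 1) → P) (w : P), Fin.snoc (α := fun _ => P) x w 0 = x 0 := fun x w =>
      Fin.snoc_castSucc (α := fun _ => P) w x 0
    simp only [Fin.snocEquiv_apply, lineWeightProd₂_snoc, Fin.snoc_castSucc, Fin.snoc_last, h0]
    rw [Finset.sum_filter] at ih
    calc ∑ x : Fin (k + 1) → P, ∑ w : P, (if x 0 = a then
            s.lineWeightProd₂ (fun t => g t.castSucc) (fun m => x m) * g (Fin.last _) (x i) w else 0)
        = ∑ x : Fin (k + 1) → P, (if x 0 = a then s.lineWeightProd₂ (fun t => g t.castSucc) x else 0) *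
            ∑ w, g (Fin.last _) (x i) w := by
          refine sum_congr rfl fun x _ => ?_
          by_cases hx : x 0 = a
          · simp only [hx, if_true, Finset.mul_sum]
          · simp [hx]
      _ ≤ ∑ x : Fin (k + 1) → P, (if x 0 = a then s.lineWeightProd₂ (fun t => g t.castSucc) x else 0) * B (Fin.last _) := by
          refine sum_le_sum fun x _ => mul_le_mul_of_nonneg_left (hB _ _) ?_
          split_ifs
          · exact lineWeightProd₂_nonneg s _ (fun t b c => hg _ b c) x
          · exact le_rfl
      _ = (∑ x : Fin (k + 1) → P, if x 0 = a then s.lineWeightProd₂ (fun t => g t.castSucc) x else 0) * B (Fin.last _) := by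
          rw [Finset.sum_mul]
      _ ≤ (∏ t : Fin k, B t.castSucc) * B (Fin.last _) := mul_le_mul_of_nonneg_right ih (hB0 _)

end Script

/-! ### The short memory property: summing the scale labels of a tree -/

section Scales

variable {H : ℕ}

/-- The scale-jump factor `θ^{h_child - h_parent}` for increasing scales, `0` otherwise. [folklore] -/
def scaleWeight (θ : ℝ) (b c : Fin (H + 1)) : ℝ :=
  if b < c then θ ^ ((c : ℕ) - b) else 0

/-- `scaleWeight ≥ 0` for `θ ≥ 0`. [folklore] -/
theorem scaleWeight_nonneg {θ : ℝ} (hθ : 0 ≤ θ) (b c : Fin (H + 1)) : 0 ≤ scaleWeight θ b c := by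
  unfold scaleWeight
  split_ifs
  · exact pow_nonneg hθ _
  · exact le_rfl

/-- **Row sums of the scale-jump factor**: `Σ_{c > b} θ^{c - b} ≤ θ/(1 - θ)` for `0 ≤ θ < 1`, uniformly
in the window of scales. [folklore] -/
theorem sum_scaleWeight_le {θ : ℝ} (hθ0 : 0 ≤ θ) (hθ1 : θ < 1) (b : Fin (H + 1)) :
    ∑ c, scaleWeight θ b c ≤ θ / (1 - θ) := by
  classical
  -- inject `c > b` into the jump `d = c - b - 1 ∈ ℕ` and compare with the geometric series
  have hinj : Set.InjOn (fun c : Fin (H + 1) => (c : ℕ) - b - 1) (univ.filter fun c : Fin (H + 1) => b < c : Finset _) := by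
    intro c hc c' hc' h
    simp only [coe_filter, mem_univ, true_and, Set.mem_setOf_eq, Fin.lt_def] at hc hc'
    exact Fin.ext (by simp only at h; omega)
  calc ∑ c, scaleWeight θ b c = ∑ c ∈ univ.filter (fun c : Fin (H + 1) => b < c), θ ^ ((c : ℕ) - b) := by
        rw [Finset.sum_filter]
        rfl
    _ = ∑ c ∈ univ.filter (fun c : Fin (H + 1) => b < c), θ * θ ^ ((c : ℕ) - b - 1) := by
        refine sum_congr rfl fun c hc => ?_
        have hlt : (b : ℕ) < c := Fin.lt_def.1 (mem_filter.1 hc).2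
        rw [← pow_succ', show (c : ℕ) - b - 1 + 1 = c - b by omega]
    _ = θ * ∑ c ∈ univ.filter (fun c : Fin (H + 1) => b < c), θ ^ ((c : ℕ) - b - 1) := by rw [mul_sum]
    _ = θ * ∑ d ∈ (univ.filter fun c : Fin (H + 1) => b < c).image (fun c : Fin (H + 1) => (c : ℕ) - b - 1), θ ^ d := by
        rw [sum_image hinj]
    _ ≤ θ * ∑' d : ℕ, θ ^ d := by
        refine mul_le_mul_of_nonneg_left ?_ hθ0
        exact (summable_geometric_of_lt_one hθ0 hθ1).sum_le_tsum _ (fun d _ => pow_nonneg hθ0 d)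
    _ = θ / (1 - θ) := by rw [tsum_geometric_of_lt_one hθ0 hθ1, div_eq_mul_inv]

variable {ι : Type*} {root : ι}

/-- **The short memory property** (summing the scale labels of a tree): for `0 ≤ θ < 1` and a tree
with `k` lines given by a script, the sum over scale labels `h : Fin (k+1) → Fin (H+1)` with the root
scale held at `a` of `∏_{lines} θ^{h_child - h_parent} · 1[h_child > h_parent]` is at most
`(θ/(1-θ))^k` — uniformly in the window `H` (Mastropietro 2008, §3.1–3.2; Benfatto–Giuliani–
Mastropietro 2006, §3). [cite: Mastropietro2008, §3.2 after (3.25)] -/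
theorem Script.sum_scaleWeightProd_le {θ : ℝ} (hθ0 : 0 ≤ θ) (hθ1 : θ < 1) {k : ℕ} (s : Script root k)
    (a : Fin (H + 1)) :
    ∑ h ∈ univ.filter (fun h : Fin (k + 1) → Fin (H + 1) => h 0 = a),
        s.lineWeightProd₂ (fun _ => scaleWeight θ) h ≤ (θ / (1 - θ)) ^ k := by
  classical
  calc _ ≤ ∏ _t : Fin k, θ / (1 - θ) :=
        s.sum_lineWeightProd₂_le (fun _ => scaleWeight θ) (fun _ b c => scaleWeight_nonneg hθ0 b c) (fun _ => θ / (1 - θ))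
          (fun _ b => sum_scaleWeight_le hθ0 hθ1 b) a
    _ = (θ / (1 - θ)) ^ k := by rw [prod_const, card_univ, Fintype.card_fin]

end Scales

end BattleFederbush

end Literature.Probability.LatticeModels
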